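import Literature.MathematicalPhysics.QuantumFieldTheory.Balaban1983to89.B5Hk163Holder
import Literature.MathematicalPhysics.QuantumFieldTheory.Balaban1983to89.B5Hk163Rate

/-!
# `Balaban1983to89.B5Hk163HolderEuclid` — the printed weighted alias sum of the (1.63) multipliers with the EUCLIDEAN length `|p′+l|` of the centred fine momentum (closes the lattice-vs-Euclidean caveat of `B5Hk163Holder`)

T. Bałaban, *Propagators and renormalization transformations for lattice gauge theories. I*, Commun. Math.
Phys. **95**, 17–40 (1984) [`Balaban1984PropagatorsI`, cell paper B5], p. 28 bottom – p. 29 top [PDF 12–13],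
verbatim (renders `…rt-I-p012-x2.png`, `…-p013-x2.png` read as images): «Another important property is that the
sum over l of the absolute value of this expression multiplied by |∂_ν(p′+l)||p′+l|^α is bounded by a constant
dependent on d only.»

`B5Hk163Holder.weighted_alias_sum_le_real` certifies this with `|p′+l|` read as the LATTICE length
`Δ^η(p′+l)^{1/2} = (Σ_ν′ |∂_ν′(p′+l)|²)^{1/2}`.  This short module converts to the literal EUCLIDEAN reading: for the
centred (symmetric) representative `q̃ = King1986.symmAlias n l p′ ∈ [−πn, πn]^d` of the fine momentum `p′+l`
(`B5Hk163Rate.isRep_symmAlias`), Jordan's inequality `(4/π²)|q̃|² ≤ Δ^η(q̃) = Δ^η(p′+l)`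
(`B5Hk163Rate.DeltaXir_ge_momSq`, `IsRep.DeltaXir_eq`; `King1986.momSq q = Σ_ν q_ν²`) gives
`|q̃|^α ≤ (π/2)^α·Δ^η(p′+l)^{α/2}`, whence

* `sum_norm_dC_sq_ofReal`: `Σ_ν ‖dC n l (ofRealVec p′) ν‖² = Δ^η(p′+l)` (`= DeltaXir n 0 (shiftr n l p′)`);
* `momSq_symmAlias_le`: `|q̃|² ≤ (π²/4)·Σ_ν ‖∂_ν(p′+l)‖²`;
* `euclidWeight_le`: `|∂_ν(p′+l)|·|q̃|^α ≤ (π/2)^α · wt163 n l (ofRealVec p′) ν α`;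
* **`weighted_alias_sum_le_euclid`**: for `d ≥ 1`, every `n ≥ 1`, `p′ ∈ [−π,π]^d`, all `μ, λ, ν`, `0 ≤ α < 1`:
  `Σ_{l} ‖h163 n μ λ l p′‖ · |∂_ν(p′+l)| · |q̃_l|^α ≤ (π/2)^α · CHolder163 d α` — the printed weight literally
  (`∂_ν(p′+l) = B5Prop11Fiber.dSym`, the genuine lattice symbol), constants depending on `d` and `α` only.

All `[folklore]`; `[cite: …]` tags are TEXT LOCATIONS only; nothing printed is a hypothesis (ABSOLUTE RULE).
HONEST SCOPE as in `B5Hk163Holder`: constant ours and crude, `(d, α)`-dependent (print: «d only», `α` fixed); the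
Hölder consequence for a typed `∂_ν(H_kB)_μ` is NOT claimed (cell GAPS G-b05g10-5); `U = 1`, `m² = 0`; NOT summit
progress.
-/

open scoped BigOperators Real
open Finset Complex

namespace Literature.MathematicalPhysics.QuantumFieldTheory.Balaban1983to89.B5Hk163HolderEuclid

open Literature.MathematicalPhysics.QuantumFieldTheory.Balaban1983to89.B4Strip (DeltaXir Sxir shiftr ofRealVec)
open Literature.MathematicalPhysics.QuantumFieldTheory.Balaban1983to89.B4ContourShift (BZ ofRealVec_mem_Strip)
open Literature.MathematicalPhysics.QuantumFieldTheory.Balaban1983to89.B5Prop11Fiber (dSym norm_dSym_sq)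
open Literature.MathematicalPhysics.QuantumFieldTheory.Balaban1983to89.B5Hk163Strip (dC dC_ofReal h163 kappa163
  kappa163_pos)
open Literature.MathematicalPhysics.QuantumFieldTheory.Balaban1983to89.B5Hk163Holder (wt163 wt163_nonneg CHolder163
  weighted_alias_sum_le_real)
open Literature.MathematicalPhysics.QuantumFieldTheory.Balaban1983to89.B5Hk163Rate (IsRep isRep_symmAlias
  DeltaXir_ge_momSq)
open Literature.MathematicalPhysics.QuantumFieldTheory.King1986 (symmAlias momSq momSq_nonneg)

noncomputable section

variable {d : ℕ} (n : ℕ) [NeZero n]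

omit [NeZero n] in
/-- `Σ_ν ‖∂_ν(p′+l)‖² = Δ^η(p′+l)` at real momenta. [folklore] -/
theorem sum_norm_dC_sq_ofReal (k : Fin d → Fin n) (s : Fin d → ℝ) :
    ∑ ν, ‖dC n k (ofRealVec s) ν‖ ^ 2 = DeltaXir n 0 (shiftr n k s) := by
  simp_rw [dC_ofReal, norm_dSym_sq]
  simp [DeltaXir]

/-- a point of the Brillouin zone has coordinates in `[−π, π]`. [folklore] -/
theorem abs_le_pi_of_mem_BZ {s : Fin d → ℝ} (hs : s ∈ BZ d) (ν : Fin d) : |s ν| ≤ π :=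
  abs_le.mpr ⟨hs.1 ν, hs.2 ν⟩

/-- JORDAN: the squared Euclidean length of the centred representative `q̃` of `p′+l` is at most
`(π²/4)·Σ_ν ‖∂_ν(p′+l)‖²`. [folklore] -/
theorem momSq_symmAlias_le (k : Fin d → Fin n) {s : Fin d → ℝ} (hs : s ∈ BZ d) :
    momSq (symmAlias n k s) ≤ π ^ 2 / 4 * ∑ ν, ‖dC n k (ofRealVec s) ν‖ ^ 2 := by
  have hn : 1 ≤ n := Nat.one_le_iff_ne_zero.mpr (NeZero.ne n)
  have hrep : IsRep n k s (symmAlias n k s) := isRep_symmAlias hn k (abs_le_pi_of_mem_BZ hs)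
  have h1 := DeltaXir_ge_momSq hn hrep.zone
  rw [← hrep.DeltaXir_eq hn, ← sum_norm_dC_sq_ofReal] at h1
  have hπ := Real.pi_pos
  have e : momSq (symmAlias n k s) = π ^ 2 / 4 * (4 / π ^ 2 * momSq (symmAlias n k s)) := by
    field_simp
  rw [e]
  exact mul_le_mul_of_nonneg_left h1 (by positivity)

/-- the literal printed weight is dominated by the lattice one: `|∂_ν(p′+l)|·|q̃|^α ≤ (π/2)^α·wt163`. [folklore] -/
theorem euclidWeight_le (k : Fin d → Fin n) {s : Fin d → ℝ} (hs : s ∈ BZ d) (ν₀ : Fin d) {α : ℝ}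
    (hα0 : 0 ≤ α) :
    ‖dSym n k s ν₀‖ * momSq (symmAlias n k s) ^ (α / 2) ≤ (π / 2) ^ α * wt163 n k (ofRealVec s) ν₀ α := by
  have hπ := Real.pi_pos
  have hm0 : 0 ≤ momSq (symmAlias n k s) := momSq_nonneg _
  have hS0 : 0 ≤ ∑ ν, ‖dC n k (ofRealVec s) ν‖ ^ 2 := Finset.sum_nonneg (fun _ _ => sq_nonneg _)
  have h := momSq_symmAlias_le n k hs
  have h2 : momSq (symmAlias n k s) ^ (α / 2) ≤
      (π / 2) ^ α * (∑ ν, ‖dC n k (ofRealVec s) ν‖ ^ 2) ^ (α / 2) := by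
    have h3 : (π ^ 2 / 4 : ℝ) ^ (α / 2) = (π / 2) ^ α := by
      rw [show (π ^ 2 / 4 : ℝ) = (π / 2) ^ 2 by ring, ← Real.rpow_two, ← Real.rpow_mul (by positivity)]
      congr 1; ring
    calc momSq (symmAlias n k s) ^ (α / 2)
        ≤ (π ^ 2 / 4 * ∑ ν, ‖dC n k (ofRealVec s) ν‖ ^ 2) ^ (α / 2) := Real.rpow_le_rpow hm0 h (by linarith)
      _ = (π ^ 2 / 4 : ℝ) ^ (α / 2) * (∑ ν, ‖dC n k (ofRealVec s) ν‖ ^ 2) ^ (α / 2) :=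
          Real.mul_rpow (by positivity) hS0
      _ = (π / 2) ^ α * (∑ ν, ‖dC n k (ofRealVec s) ν‖ ^ 2) ^ (α / 2) := by rw [h3]
  unfold wt163
  rw [dC_ofReal]
  calc ‖dSym n k s ν₀‖ * momSq (symmAlias n k s) ^ (α / 2)
      ≤ ‖dSym n k s ν₀‖ * ((π / 2) ^ α * (∑ ν, ‖dC n k (ofRealVec s) ν‖ ^ 2) ^ (α / 2)) :=
        mul_le_mul_of_nonneg_left h2 (norm_nonneg _)
    _ = (π / 2) ^ α * (‖dSym n k s ν₀‖ * (∑ ν, ‖dC n k (ofRealVec s) ν‖ ^ 2) ^ (α / 2)) := by ring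

/-- **THE PRINTED WEIGHTED ALIAS SUM, EUCLIDEAN READING**: for `d ≥ 1`, every `n ≥ 1`, `p′ = s ∈ [−π,π]^d`, all
`μ, λ, ν` and `0 ≤ α < 1`, with `q̃_l = symmAlias n l s` the centred representative of `p′+l` in `[−πn, πn]^d`:
`Σ_l ‖h_{l;μλ}(p′)‖ · |∂_ν(p′+l)| · |q̃_l|^α ≤ (π/2)^α · C_H(d, α)`.
[cite: Balaban1984PropagatorsI, p.29 lines 1–2 (text of the claim only; proof and constant ours)] [folklore] -/
theorem weighted_alias_sum_le_euclid {s : Fin d → ℝ} (hs : s ∈ BZ d) (μ lam ν₀ : Fin d) {α : ℝ}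
    (hα0 : 0 ≤ α) (hα1 : α < 1) :
    ∑ k : Fin d → Fin n, ‖h163 n μ lam k (ofRealVec s)‖ *
        (‖dSym n k s ν₀‖ * momSq (symmAlias n k s) ^ (α / 2)) ≤ (π / 2) ^ α * CHolder163 d α := by
  have hπ := Real.pi_pos
  have hmain := weighted_alias_sum_le_real n hs μ lam ν₀ hα0 hα1
  calc ∑ k : Fin d → Fin n, ‖h163 n μ lam k (ofRealVec s)‖ *
          (‖dSym n k s ν₀‖ * momSq (symmAlias n k s) ^ (α / 2))
      ≤ ∑ k : Fin d → Fin n, ‖h163 n μ lam k (ofRealVec s)‖ * ((π / 2) ^ α * wt163 n k (ofRealVec s) ν₀ α) :=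
        Finset.sum_le_sum (fun k _ =>
          mul_le_mul_of_nonneg_left (euclidWeight_le n k hs ν₀ hα0) (norm_nonneg _))
    _ = (π / 2) ^ α * ∑ k : Fin d → Fin n, ‖h163 n μ lam k (ofRealVec s)‖ * wt163 n k (ofRealVec s) ν₀ α := by
        rw [Finset.mul_sum]
        exact Finset.sum_congr rfl (fun k _ => by ring)
    _ ≤ (π / 2) ^ α * CHolder163 d α := mul_le_mul_of_nonneg_left hmain (by positivity)

end

end Literature.MathematicalPhysics.QuantumFieldTheory.Balaban1983to89.B5Hk163HolderEuclid
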